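import Summits.CriticalPhenomena.PercolationContinuityZ3.Theorems.PercNearOneGluingNoHeavyLowerTailBHKRowApexWiredGadget
import Summits.CriticalPhenomena.PercolationContinuityZ3.Theorems.PercNearOneGluingNoHeavyLowerTailBHKRowRandomCluster
import HarnessLib

/-!
# `NoHeavyLowerTail` (stmt-CriticalPhenomena-4575) — the pendant-path gadget, II: measure transfer and connectivity off the apex

Support file (prover prim-gen-kcluster gen 56; `--supports stmt-CriticalPhenomena-4575`).  No named facts, no sorries, no
definitions.  Continues `…BHKRowApexWiredGadget` (gadget pairs `Γ`, lift `ι(ω) ∪ Γ`,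
parameters `w†` on `V ⊕ Z`, `W_{w†,q}(ι(ω) ∪ Γ) = W^{B}_{w,q}(ω)` with `B = {a} ∪ att(Z)`):

* `rcMeasureW_real_gadget` — **the transfer**: `φ_{w†,q}(A) = φ^{B}_{w,q}{ω | ι(ω) ∪ Γ ∈ A}` for every event `A` of
  `V ⊕ Z`-configurations (`φ_{w†,q} = rcMeasureW w† q ∅` free, `φ^B_{w,q} = rcMeasureW w q B` wired on `B`, `0 < q`):
  the free weight is carried by the lifts (`sum_eq_sum_liftCfg`) and the partition functions agree (`rcPartitionFunctionW_gadget`);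
* `reachable_delVertex_liftCfg_iff` — reachability between old vertices OFF `inl a` in `ι(ω) ∪ Γ` is reachability off `a`
  in `ω` (a gadget vertex `inr z` is a pendant of its foot `inl (att z)` once `inl a` is deleted);
* `exists_inl_port_iff_reachable` — the split cluster `C^{inl a}_{inl b}(ι(ω) ∪ Γ)` has a port at `inl a` through an OLD
  pair iff `a ↔ b` in `ω` (the gadget ports `{inr z, inl a}` are always present and are not read).
Used in `…BHKRowApexWired`. [this work; pattern cited: Grimmett2006, §4.2; VandenbergHaggstromKahn2005 Thm. 1.4]
-/

noncomputable section

namespace Summit.CriticalPhenomena.PercolationContinuityZ3.Theorems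

namespace PivotalBHK

namespace ApexWired

open Literature.Probability.Percolation Literature.Probability.Percolation.BHK2006
open Literature.Probability.LatticeModels SimpleGraph
open scoped Classical

variable {V Z : Type*}

/-! ### The measure transfer: free on `V ⊕ Z` with parameters `w†` = wired on `B` with parameters `w` -/

section Transfer

variable [Fintype V] [Fintype Z] (w : Sym2 V → unitInterval) (a : V) (att : Z → V)

/-- **Weights**: `W_{w†,q}(ι(ω) ∪ Γ) = W^{B}_{w,q}(ω)`. [this work] -/
theorem rcWeightW_liftCfg (q : ℝ) (ω : BondConfig V) :
    rcWeightW (gadgetW w a att) q ∅ (liftCfg a att ω) = rcWeightW w q (gadgetBlock a att) ω := by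
  unfold rcWeightW
  rw [weight_liftCfg, clusterCount_liftCfg]

/-- Off the lifts the free weight vanishes. [this work] -/
theorem rcWeightW_eq_zero_of_ne_lift (q : ℝ) (ω' : BondConfig (V ⊕ Z)) (h : ω' ≠ liftCfg a att (projCfg ω')) :
    rcWeightW (gadgetW w a att) q ∅ ω' = 0 := by
  unfold rcWeightW
  rw [weight_eq_zero_of_ne_lift w a att ω' h, zero_mul]

/-- Sums over the configurations of `V ⊕ Z` of functions vanishing off the lifts are sums over the configurations of
`V`. [this work] -/
theorem sum_eq_sum_liftCfg (F : BondConfig (V ⊕ Z) → ℝ) (hF : ∀ ω', ω' ≠ liftCfg a att (projCfg ω') → F ω' = 0) :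
    ∑ ω', F ω' = ∑ ω, F (liftCfg a att ω) := by
  have himg : Finset.univ.image (liftCfg a att) ⊆ (Finset.univ : Finset (BondConfig (V ⊕ Z))) :=
    Finset.subset_univ _
  rw [← Finset.sum_subset himg, Finset.sum_image fun x _ y _ h => liftCfg_injective a att h]
  intro ω' _ hω'
  refine hF ω' fun h => hω' ?_
  exact Finset.mem_image.2 ⟨projCfg ω', Finset.mem_univ _, h.symm⟩

/-- **Partition functions**: `Z_{w†,q} = Z^{B}_{w,q}`. [this work] -/
theorem rcPartitionFunctionW_gadget (q : ℝ) :
    rcPartitionFunctionW (gadgetW w a att) q ∅ = rcPartitionFunctionW w q (gadgetBlock a att) := by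
  unfold rcPartitionFunctionW
  rw [sum_eq_sum_liftCfg a att _ (rcWeightW_eq_zero_of_ne_lift w a att q)]
  exact Finset.sum_congr rfl fun ω _ => rcWeightW_liftCfg w a att q ω

/-- **The transfer**: for every event `A` of `V ⊕ Z`-configurations,
`φ_{w†,q}(A) = φ^{B}_{w,q}{ω | ι(ω) ∪ Γ ∈ A}` — the free measure of the gadget graph IS the measure wired on
`B = {a} ∪ att(Z)`, read through the lift. [this work] -/
theorem rcMeasureW_real_gadget {q : ℝ} (hq : 0 < q) (A : Set (BondConfig (V ⊕ Z))) :
    (rcMeasureW (gadgetW w a att) q ∅).real A =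
      (rcMeasureW w q (gadgetBlock a att)).real (liftCfg a att ⁻¹' A) := by
  rw [rcMeasureW_real_apply _ hq, rcMeasureW_real_apply _ hq, rcPartitionFunctionW_gadget w a att q]
  rw [sum_eq_sum_liftCfg a att _ fun ω' hω' => ?_]
  · refine Finset.sum_congr rfl fun ω _ => ?_
    simp only [Set.mem_preimage, rcWeightW_liftCfg w a att q ω]
  · by_cases hA : ω' ∈ A
    · rw [if_pos hA, rcWeightW_eq_zero_of_ne_lift w a att q ω' hω', zero_div]
    · rw [if_neg hA]

end Transfer

/-! ### Connectivity off the split vertex: the gadget vertices are pendant once `inl a` is deleted -/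

section OffApex

variable (a : V) (att : Z → V) (ω : BondConfig V)

/-- Adjacency in the lift with the pairs at `inl a` deleted. [this work] -/
theorem delVertex_liftCfg_adj (x y : V ⊕ Z) :
    (openGraph (delVertex (Sum.inl a) (liftCfg a att ω))).Adj x y ↔
      s(x, y) ∈ liftCfg a att ω ∧ x ≠ Sum.inl a ∧ y ≠ Sum.inl a ∧ x ≠ y :=
  openGraph_delVertex_adj _ _ x y

/-- `inl` is a graph homomorphism from `ω − a` into the lift minus `inl a`. [this work] -/
theorem delVertex_liftCfg_adj_inl {u v : V} (h : (openGraph (delVertex a ω)).Adj u v) :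
    (openGraph (delVertex (Sum.inl a) (liftCfg a att ω))).Adj (Sum.inl u) (Sum.inl v) := by
  obtain ⟨hm, hu, hv, hne⟩ := (openGraph_delVertex_adj a ω u v).1 h
  exact (delVertex_liftCfg_adj a att ω _ _).2 ⟨(inl_inl_mem_liftCfg_iff a att ω u v).2 hm,
    fun h' => hu (Sum.inl_injective h'), fun h' => hv (Sum.inl_injective h'), fun h' => hne (Sum.inl_injective h')⟩

/-- Reachability off `a` lifts. [this work] -/
theorem reachable_delVertex_liftCfg_of_reachable {u v : V} (h : (openGraph (delVertex a ω)).Reachable u v) :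
    (openGraph (delVertex (Sum.inl a) (liftCfg a att ω))).Reachable (Sum.inl u) (Sum.inl v) := by
  rw [reachable_iff_reflTransGen] at h
  induction h with
  | refl => exact Reachable.refl _
  | @tail x y _ hxy ih => exact ih.trans (delVertex_liftCfg_adj_inl a att ω hxy).reachable

/-- Reachability off `inl a` in the lift projects (along `footV`) to reachability off `a` in `ω`: a step into a gadget
vertex `inr z` can only come from its foot `inl (att z)`. [this work] -/
theorem reachable_delVertex_of_liftCfg {x y : V ⊕ Z}
    (h : (openGraph (delVertex (Sum.inl a) (liftCfg a att ω))).Reachable x y) :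
    (openGraph (delVertex a ω)).Reachable (footV att x) (footV att y) := by
  have step : ∀ (u : V) (z : Z), s(Sum.inl u, Sum.inr z) ∈ liftCfg a att ω → Sum.inl u ≠ (Sum.inl a : V ⊕ Z) →
      u = att z := by
    intro u z hm hu
    rcases (inl_inr_mem_liftCfg_iff a att ω u z).1 hm with rfl | h
    · exact absurd rfl hu
    · exact h
  rw [reachable_iff_reflTransGen] at h
  induction h with
  | refl => exact Reachable.refl _
  | @tail x' y' _ hxy ih =>
    refine ih.trans ?_
    obtain ⟨hm, hx, hy, hne⟩ := (delVertex_liftCfg_adj a att ω x' y').1 hxy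
    cases x' with
    | inl u => cases y' with
      | inl v =>
        refine Adj.reachable ((openGraph_delVertex_adj a ω u v).2 ⟨(inl_inl_mem_liftCfg_iff a att ω u v).1 hm,
          fun h' => hx (by rw [h']), fun h' => hy (by rw [h']), fun h' => hne (by rw [h'])⟩)
      | inr z => simp only [footV]; rw [step u z hm hx]
    | inr z => cases y' with
      | inl u => simp only [footV]; rw [Sym2.eq_swap] at hm; rw [step u z hm hy]
      | inr z' => exact absurd hm (inr_inr_not_mem_liftCfg a att ω z z')

/-- **Reachability off the apex is unchanged by the gadget** (for old vertices). [this work] -/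
theorem reachable_delVertex_liftCfg_iff (u v : V) :
    (openGraph (delVertex (Sum.inl a) (liftCfg a att ω))).Reachable (Sum.inl u) (Sum.inl v) ↔
      (openGraph (delVertex a ω)).Reachable u v :=
  ⟨fun h => reachable_delVertex_of_liftCfg a att ω h, reachable_delVertex_liftCfg_of_reachable a att ω⟩

/-- **The split cluster of `inl b` has a port at `inl a` through an OLD pair iff `a ↔ b` in `ω`** (`a ≠ b`): the lifted
form of `exists_mem_splitCl_iff_reachable`, reading only the `inl–inl` port pairs (the gadget ports `{inr z, inl a}` are
always present and carry no information). [this work] -/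
theorem exists_inl_port_iff_reachable {b : V} (hab : a ≠ b) :
    (∃ e ∈ splitCl (Sum.inl a) (liftCfg a att ω) {Sum.inl b}, ∃ u : V, e = s(Sum.inl a, Sum.inl u)) ↔
      (openGraph ω).Reachable a b := by
  constructor
  · rintro ⟨e, ⟨he, -, x, hx, s, hs, hsx⟩, u, rfl⟩
    rw [Set.mem_singleton_iff] at hs
    subst hs
    -- the endpoint reached from `inl b` off `inl a` is `inl u`
    have hxu : x = Sum.inl u := by
      rcases Sym2.mem_iff.1 hx with rfl | rfl
      · exact absurd (eq_of_reachable_delVertex hsx) (fun h => hab (Sum.inl_injective h).symm)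
      · rfl
    subst hxu
    have hbu : (openGraph (delVertex a ω)).Reachable b u := (reachable_delVertex_liftCfg_iff a att ω b u).1 hsx
    have hau : (openGraph ω).Adj a u := by
      refine (openGraph_adj ω a u).2 ⟨(inl_inl_mem_liftCfg_iff a att ω a u).1 he, ?_⟩
      rintro rfl
      exact hab (eq_of_reachable_delVertex hbu).symm
    exact hau.reachable.trans (hbu.mono (openGraph_le (delVertex_subset a ω))).symm
  · intro h
    -- a port of the split cluster of `b` in `ω` (tree lemma), lifted
    have hb : a ∉ ({b} : Set V) := fun h' => hab (Set.mem_singleton_iff.1 h')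
    obtain ⟨e, ⟨he, -, u, hu, s, hs, hsu⟩, hae⟩ := (exists_mem_splitCl_iff_reachable hab ω).2 h
    rw [Set.mem_singleton_iff] at hs
    subst hs
    have hua : u ≠ a := ne_of_splitReach hb ⟨s, rfl, hsu⟩
    have heq : e = s(u, a) := (Sym2.mem_and_mem_iff hua).1 ⟨hu, hae⟩
    subst heq
    refine ⟨s(Sum.inl a, Sum.inl u), ⟨?_, ?_, Sum.inl u, Sym2.mem_mk_right _ _, Sum.inl s, rfl,
      reachable_delVertex_liftCfg_of_reachable a att ω hsu⟩, u, rfl⟩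
    · rw [Sym2.eq_swap]; exact (inl_inl_mem_liftCfg_iff a att ω u a).2 he
    · rw [Sym2.mk_isDiag_iff]; exact fun h' => hua (Sum.inl_injective h').symm

end OffApex

end ApexWired

end PivotalBHK

end Summit.CriticalPhenomena.PercolationContinuityZ3.Theorems

end
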